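import Summits.QuantumAdvantage.QuantumAdvantage.Theorems.CubicForrelationNearExactIsExactEightSymplectic
import Summits.QuantumAdvantage.QuantumAdvantage.Theorems.CubicForrelationNearExactIsExactTwelveWindowPairing
import Summits.QuantumAdvantage.QuantumAdvantage.Theorems.CubicForrelationNearExactIsExactTwelveWindowHyperplane

/-!
# Crux `CubicForrelation.NearExactIsExact` (stmt-QuantumAdvantage-14043) — n = 12: GRANULARITY of the character sums of a quadratic sign
  pattern on a hyperplane whose 4-flat sums are all `≡ 0 (mod 8)`

Certificate seat `b2b-cforr-cert` (gen 20).  HONEST FRAMING: an elementary lemma (standard axioms) about quadratic Boolean functions on 12 bits,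
the new ingredient of the level-5 analysis AT the value `Φ = 930/1024` (see HOME/b2b-cforr-cert-g20/PROOF-N12-930-L5.md); finite-slice
infrastructure, NOT summit progress, NO new value of `θ₁₂` claimed here.

Setting: `D` of degree `≤ 2` on `𝔽₂¹²`, `σ = (−1)^D`, a hyperplane `P = {(−1)^{γ·x} = t}` (`γ ≠ 0`, `t = ±1`) with direction space
`V = γ^⊥`, and the HYPOTHESIS that every parametrised 4-flat sum `Σ_ε σ(x ⊕ ε·(a,b,c,d))` with `x ∈ P`, `a, b, c, d ∈ V` is `≡ 0 (mod 8)`.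
(For a level-5 side at `Φ ≥ 930/1024` this hypothesis holds for the quadratic digit: the residual `e` vanishes off the odd hyperplane `P`,
is `≡ σ (mod 8)` on `P` after round 1 of the parity cascade, and its 5-flat sums over `A ∪ (A ⊕ v)`, `A ⊂ P` a 4-flat, `v ∉ V`, are
`≡ 0 (mod 8)` by Ax — …TwelveLevelFive930Structure's `hflat5`.)

CONCLUSION `gr20_hyperplane_granular`: every character sum `Ŝ(y) = Σ_{x∈P} σ(x)(−1)^{x·y}` is `0` or has `|Ŝ(y)| ≥ 1024`
(`gr20_hyperplane_granular_m`: with `Ŝ = 64m`, `m(y) = 0` or `|m(y)| ≥ 16`).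

Proof (symplectic, classification-free; the form `B(a,b) = D(0) ⊕ D(a) ⊕ D(b) ⊕ D(a⊕b)` and the frame sum `±4` are …EightSymplectic's):
* `gr20_radical_ge`: the relative radical `R = {t ∈ V : B(t,·) ≡ 0 on V}` has `#R ≥ 512`.  Otherwise some `a, b ∈ V` have `B(a,b) = 1`;
  `V' = V ∩ a^⊥ ∩ b^⊥` has `#V' ≥ 512` (`v ↦ v ⊕ B(b,v)a ⊕ B(a,v)b` maps `V` onto `V'` at most four-to-one); a pair `c, d ∈ V'` with
  `B(c,d) = 1` would be a symplectic frame, whose 4-flat sum is `±4` (`es_flat_signsum`) — excluded by the hypothesis; so `B ≡ 0` on `V'`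
  and then `V' ⊆ R`.
* `gr20_corr_radical` / `gr20_corr_zero`: the correlation `C(t) = Σ_{x∈P} σ(x)σ(x⊕t)` is `2048·η(t)` (`η(t) = σ(x₀)σ(x₀⊕t)`) for `t ∈ R`
  and `0` for `t ∈ V ∖ R` (the involution `x ↦ x ⊕ v`, `B(t,v) = 1`, flips the sign).
* `gr20_Shat_sq`: `Ŝ(y)² = Σ_{t∈V} (−1)^{t·y} C(t) = 2048·S_R(y)`, `S_R(y) = Σ_{t∈R} η(t)(−1)^{t·y}`; `gr20_SR_sq`: `η` is multiplicative on
  the group `R`, so `S_R(y)² = #R·S_R(y)`, `S_R ∈ {0, #R}`; hence `Ŝ(y)² ∈ {0} ∪ [2^20, ∞)`.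

References: L. E. Dickson (1901) Ch. VIII; MacWilliams–Sloane (1977) Ch. 15 §2; C. Carlet (2021) §5.2.  Everything below is proved from
Mathlib and the tree; axioms are the standard three.
-/

set_option linter.dupNamespace false -- D-0017: single-problem summit ⇒ `QuantumAdvantage.QuantumAdvantage` by design

noncomputable section

namespace Summit.QuantumAdvantage.QuantumAdvantage.Theorems.CubicForrelation.NearExactIsExact

open Finset
open Literature.Computability.QuantumComplexity
open Literature.Computability.QuantumComplexity.BuzetChailloux (bxor zeroVec bxor_bxor_cancel_left bxor_zeroVec zeroVec_bxor bxor_comm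
  bxor_self twist_zeroVec_right twist_bxor_right)
open Literature.Computability.QuantumComplexity.DerivativeWalsh (twist_bxor_left)
open Literature.Computability.QuantumComplexity.Simon (twist_eq_one_or twist_mul_self)

variable {n : ℕ}

/-! ### Small tools -/

/-- Additivity of the second-derivative form in its second argument. [cite: Carlet2020, §5.2] -/
theorem gr20_B_add_right (D : (Fin n → Bool) → Bool) (hD : IsDegLeFun 2 D) (a u w : Fin n → Bool) :
    (D zeroVec ^^ D a ^^ D (bxor u w) ^^ D (bxor a (bxor u w))) =
      ((D zeroVec ^^ D a ^^ D u ^^ D (bxor a u)) ^^ (D zeroVec ^^ D a ^^ D w ^^ D (bxor a w))) := by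
  rw [es_B_symm D a (bxor u w), es_B_add_left D hD u w a, es_B_symm D u a, es_B_symm D w a]

/-- `B(a, 0) = 0`. [folklore] -/
theorem gr20_B_zero_right (D : (Fin n → Bool) → Bool) (a : Fin n → Bool) :
    (D zeroVec ^^ D a ^^ D zeroVec ^^ D (bxor a zeroVec)) = false := by
  rw [bxor_zeroVec]; cases D zeroVec <;> cases D a <;> rfl

/-- `B(a, if p then b else 0) = p ∧ B(a,b)`. [folklore] -/
theorem gr20_B_ite_right (D : (Fin n → Bool) → Bool) (a b : Fin n → Bool) (p : Bool) :
    (D zeroVec ^^ D a ^^ D (if p then b else zeroVec) ^^ D (bxor a (if p then b else zeroVec))) =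
      (p && (D zeroVec ^^ D a ^^ D b ^^ D (bxor a b))) := by
  cases p
  · rw [if_neg (by decide), Bool.false_and]; exact gr20_B_zero_right D a
  · rw [if_pos rfl, Bool.true_and]

/-- Translating a translation-closed finite set does not change a sum over it. [folklore] -/
theorem gr20_sum_translate {S : Finset (Fin n → Bool)} {v : Fin n → Bool} (hS : ∀ x ∈ S, bxor x v ∈ S) (F : (Fin n → Bool) → ℝ) :
    ∑ x ∈ S, F (bxor x v) = ∑ x ∈ S, F x := by
  refine Finset.sum_nbij' (fun x => bxor x v) (fun x => bxor x v) hS hS (fun x _ => ?_) (fun x _ => ?_) (fun x _ => rfl)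
  · rw [iw_bxor_assoc, bxor_self, bxor_zeroVec]
  · rw [iw_bxor_assoc, bxor_self, bxor_zeroVec]

/-- `signOf (a ⊕ b) = signOf a · signOf b` (re-export of `signOf_xor` in product-first form). [folklore] -/
theorem gr20_signOf_mul (a b : Bool) : signOf a * signOf b = signOf (a ^^ b) := (signOf_xor a b).symm

/-! ### The relative radical is large -/

/-- **The relative radical has at least `512` elements** when all 4-flat sums of `(−1)^D` inside the hyperplane are `≡ 0 (mod 8)`.  See the
module docstring. [this work] -/
theorem gr20_radical_ge (D : (Fin (6 + 6) → Bool) → Bool) (hD : IsDegLeFun 2 D) (γ : Fin (6 + 6) → Bool) (hγ : γ ≠ zeroVec)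
    (t : ℝ) (ht : t = 1 ∨ t = -1)
    (H8 : ∀ x : Fin (6 + 6) → Bool, twist γ x = t → ∀ a b c d : Fin (6 + 6) → Bool, twist γ a = 1 → twist γ b = 1 → twist γ c = 1 →
      twist γ d = 1 → (8 : ℤ) ∣ ∑ ε : Fin 4 → Bool, sZ (D (fun j => x j ^^ decide (Odd #(univ.filter fun i =>
        ε i && (![a, b, c, d] : Fin 4 → Fin (6 + 6) → Bool) i j))))) :
    512 ≤ #((univ.filter fun a : Fin (6 + 6) → Bool => twist γ a = 1).filter fun a =>
      ∀ v ∈ (univ.filter fun a : Fin (6 + 6) → Bool => twist γ a = 1), (D zeroVec ^^ D a ^^ D v ^^ D (bxor a v)) = false) := by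
  classical
  set V := univ.filter (fun a : Fin (6 + 6) → Bool => twist γ a = 1) with hVdef
  set R := V.filter (fun a => ∀ v ∈ V, (D zeroVec ^^ D a ^^ D v ^^ D (bxor a v)) = false) with hRdef
  have hVmem : ∀ a, a ∈ V ↔ twist γ a = 1 := fun a => by rw [hVdef, mem_filter]; simp
  have hVadd : ∀ x ∈ V, ∀ y ∈ V, bxor x y ∈ V := by
    intro x hx y hy; rw [hVmem] at hx hy ⊢; rw [twist_bxor_right, hx, hy, mul_one]
  have hV0 : zeroVec ∈ V := (hVmem _).2 (twist_zeroVec_right γ)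
  have hVcard : #V = 2048 := tw59_card_half γ hγ 1 (Or.inl rfl)
  -- a base point of the hyperplane
  have hPcard : #(univ.filter fun x : Fin (6 + 6) → Bool => twist γ x = t) = 2048 := tw59_card_half γ hγ t ht
  obtain ⟨x₀, hx₀⟩ : (univ.filter fun x : Fin (6 + 6) → Bool => twist γ x = t).Nonempty := card_pos.1 (by rw [hPcard]; norm_num)
  have hx₀t : twist γ x₀ = t := (mem_filter.1 hx₀).2
  -- the form
  have hsymm := es_B_symm D
  have haddR := gr20_B_add_right D hD
  by_contra hlt
  push Not at hlt
  -- `R ≠ V`: a vector `a ∈ V` outside the radical and a partner `b`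
  have hRV : ∃ a ∈ V, a ∉ R := by
    by_contra h
    push Not at h
    have : V ⊆ R := fun a ha => h a ha
    have := card_le_card this
    omega
  obtain ⟨a, haV, haR⟩ := hRV
  have hab : ∃ b ∈ V, (D zeroVec ^^ D a ^^ D b ^^ D (bxor a b)) = true := by
    by_contra h
    push Not at h
    exact haR (mem_filter.2 ⟨haV, fun v hv => by simpa using h v hv⟩)
  obtain ⟨b, hbV, hab1⟩ := hab
  have hba1 : (D zeroVec ^^ D b ^^ D a ^^ D (bxor b a)) = true := by rw [hsymm b a]; exact hab1
  have haa : (D zeroVec ^^ D a ^^ D a ^^ D (bxor a a)) = false := es_B_self D a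
  have hbb : (D zeroVec ^^ D b ^^ D b ^^ D (bxor b b)) = false := es_B_self D b
  -- `V' = V ∩ a^⊥ ∩ b^⊥` has at least `512` elements
  set V' := V.filter (fun v => (D zeroVec ^^ D a ^^ D v ^^ D (bxor a v)) = false ∧ (D zeroVec ^^ D b ^^ D v ^^ D (bxor b v)) = false)
    with hV'def
  set ψ : (Fin (6 + 6) → Bool) → (Fin (6 + 6) → Bool) := fun v =>
    bxor (bxor v (if (D zeroVec ^^ D b ^^ D v ^^ D (bxor b v)) then a else zeroVec))
      (if (D zeroVec ^^ D a ^^ D v ^^ D (bxor a v)) then b else zeroVec) with hψ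
  have hite : ∀ (p : Bool) (c : Fin (6 + 6) → Bool), c ∈ V → (if p then c else zeroVec) ∈ V := by
    intro p c hc; cases p
    · exact hV0
    · exact hc
  have hψV' : ∀ v ∈ V, ψ v ∈ V' := by
    intro v hv
    refine mem_filter.2 ⟨hVadd _ (hVadd _ hv _ (hite _ a haV)) _ (hite _ b hbV), ?_, ?_⟩
    · simp only [ψ]
      rw [haddR, haddR, gr20_B_ite_right, gr20_B_ite_right, haa, hab1]
      cases (D zeroVec ^^ D a ^^ D v ^^ D (bxor a v)) <;> cases (D zeroVec ^^ D b ^^ D v ^^ D (bxor b v)) <;> rfl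
    · simp only [ψ]
      rw [haddR, haddR, gr20_B_ite_right, gr20_B_ite_right, hba1, hbb]
      cases (D zeroVec ^^ D a ^^ D v ^^ D (bxor a v)) <;> cases (D zeroVec ^^ D b ^^ D v ^^ D (bxor b v)) <;> rfl
  have hV'ge : 512 ≤ #V' := by
    have himg : V.image ψ ⊆ V' := by
      intro w hw
      obtain ⟨v, hv, rfl⟩ := mem_image.1 hw
      exact hψV' v hv
    have hfib : ∀ w ∈ V.image ψ, #(V.filter fun v => ψ v = w) ≤ 4 := by
      intro w _
      have hsub : V.filter (fun v => ψ v = w) ⊆ {w, bxor w a, bxor w b, bxor (bxor w b) a} := by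
        intro v hv
        have hvw : ψ v = w := (mem_filter.1 hv).2
        simp only [ψ] at hvw
        have key : v = bxor (bxor w (if (D zeroVec ^^ D a ^^ D v ^^ D (bxor a v)) then b else zeroVec))
            (if (D zeroVec ^^ D b ^^ D v ^^ D (bxor b v)) then a else zeroVec) := by
          rw [← hvw, iw_bxor_assoc (bxor v _), bxor_self, bxor_zeroVec, iw_bxor_assoc v, bxor_self, bxor_zeroVec]
        simp only [mem_insert, mem_singleton]
        split_ifs at key <;> (try simp only [bxor_zeroVec] at key) <;> simp only [key, true_or, or_true]
      refine (card_le_card hsub).trans ?_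
      refine (card_insert_le _ _).trans ?_
      refine Nat.succ_le_succ ((card_insert_le _ _).trans (Nat.succ_le_succ ((card_insert_le _ _).trans ?_)))
      rw [card_singleton]
    have h1 := Finset.card_le_mul_card_image V 4 hfib
    have h2 := card_le_card himg
    rw [hVcard] at h1
    omega
  by_cases hframe : ∃ c ∈ V', ∃ d ∈ V', (D zeroVec ^^ D c ^^ D d ^^ D (bxor c d)) = true
  · /- a symplectic frame: its 4-flat sum is `±4`, contradicting the hypothesis -/
    obtain ⟨c, hc, d, hd, hcd⟩ := hframe
    have hcV : c ∈ V := (mem_filter.1 hc).1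
    have hdV : d ∈ V := (mem_filter.1 hd).1
    obtain ⟨hac, hbc⟩ := (mem_filter.1 hc).2
    obtain ⟨had, hbd⟩ := (mem_filter.1 hd).2
    have hsum := es_flat_signsum D hD a b c d hab1 hcd hac had hbc hbd x₀
    have h8 := H8 x₀ hx₀t a b c d ((hVmem a).1 haV) ((hVmem b).1 hbV) ((hVmem c).1 hcV) ((hVmem d).1 hdV)
    have hcast : ((∑ ε : Fin 4 → Bool, sZ (D (fun j => x₀ j ^^ decide (Odd #(univ.filter fun i =>
        ε i && (![a, b, c, d] : Fin 4 → Fin (6 + 6) → Bool) i j)))) : ℤ) : ℝ) =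
        ∑ ε : Fin 4 → Bool, signOf (D (fun j => x₀ j ^^ decide (Odd #(univ.filter fun i =>
          ε i && (![a, b, c, d] : Fin 4 → Fin (6 + 6) → Bool) i j)))) := by
      push_cast
      exact sum_congr rfl fun ε _ => tp_sZ_cast _
    obtain ⟨k, hk⟩ := h8
    rcases hsum with h4 | h4 <;> rw [h4, hk] at hcast
    · have : (8 * k : ℝ) = 4 := by exact_mod_cast hcast
      have h' : (8 : ℤ) * k = 4 := by exact_mod_cast this
      omega
    · have : (8 * k : ℝ) = -4 := by exact_mod_cast hcast
      have h' : (8 : ℤ) * k = -4 := by exact_mod_cast this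
      omega
  · /- no frame: `B ≡ 0` on `V'`, hence `V' ⊆ R` -/
    push Not at hframe
    have hframe' : ∀ c ∈ V', ∀ d ∈ V', (D zeroVec ^^ D c ^^ D d ^^ D (bxor c d)) = false := by
      intro c hc d hd; simpa using hframe c hc d hd
    have hsub : V' ⊆ R := by
      intro c hc
      have hcV : c ∈ V := (mem_filter.1 hc).1
      obtain ⟨hac, hbc⟩ := (mem_filter.1 hc).2
      have hca : (D zeroVec ^^ D c ^^ D a ^^ D (bxor c a)) = false := by rw [hsymm c a]; exact hac
      have hcb : (D zeroVec ^^ D c ^^ D b ^^ D (bxor c b)) = false := by rw [hsymm c b]; exact hbc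
      refine mem_filter.2 ⟨hcV, fun v hv => ?_⟩
      -- `B(c, v) = B(c, ψ v) ⊕ [B(b,v)]B(c,a) ⊕ [B(a,v)]B(c,b) = 0`
      have h0 := hframe' c hc (ψ v) (hψV' v hv)
      simp only [ψ] at h0
      rw [haddR, haddR, gr20_B_ite_right, gr20_B_ite_right, hca, hcb, Bool.and_false, Bool.and_false, Bool.xor_false,
        Bool.xor_false] at h0
      exact h0
    have := card_le_card hsub
    omega

/-! ### Correlations of `σ` along the hyperplane -/

/-- **Correlation along a radical direction**: for `t ∈ R`, `σ(x)σ(x⊕t)` is constant on `P`. [this work] -/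
theorem gr20_corr_radical (D : (Fin (6 + 6) → Bool) → Bool) (hD : IsDegLeFun 2 D) (V : Finset (Fin (6 + 6) → Bool))
    (x₀ t : Fin (6 + 6) → Bool) (htR : ∀ v ∈ V, (D zeroVec ^^ D t ^^ D v ^^ D (bxor t v)) = false)
    (x : Fin (6 + 6) → Bool) (hx : x ∈ V.image (bxor x₀)) :
    signOf (D x) * signOf (D (bxor x t)) = signOf (D x₀) * signOf (D (bxor x₀ t)) := by
  obtain ⟨v, hv, rfl⟩ := mem_image.1 hx
  rw [gr20_signOf_mul, gr20_signOf_mul, es_second_deriv D hD x₀ v t]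
  have hvt : (D zeroVec ^^ D v ^^ D t ^^ D (bxor v t)) = false := by rw [es_B_symm D v t]; exact htR v hv
  rw [hvt]
  cases D x₀ <;> cases D (bxor x₀ v) <;> cases D (bxor x₀ t) <;> rfl

/-- **Correlation along a non-radical direction vanishes**: if `B(t,v) = 1` for some `v ∈ V` then `Σ_{x∈P} σ(x)σ(x⊕t) = 0`.
[this work] -/
theorem gr20_corr_zero (D : (Fin (6 + 6) → Bool) → Bool) (hD : IsDegLeFun 2 D) (P V : Finset (Fin (6 + 6) → Bool))
    (hPV : ∀ x ∈ P, ∀ v ∈ V, bxor x v ∈ P) (t v : Fin (6 + 6) → Bool) (hv : v ∈ V)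
    (htv : (D zeroVec ^^ D t ^^ D v ^^ D (bxor t v)) = true) :
    ∑ x ∈ P, signOf (D x) * signOf (D (bxor x t)) = 0 := by
  have hflip : ∀ x, signOf (D (bxor x v)) * signOf (D (bxor (bxor x v) t)) = -(signOf (D x) * signOf (D (bxor x t))) := by
    intro x
    rw [gr20_signOf_mul, gr20_signOf_mul, es_second_deriv D hD x v t]
    have hvt : (D zeroVec ^^ D v ^^ D t ^^ D (bxor v t)) = true := by rw [es_B_symm D v t]; exact htv
    rw [hvt]
    cases D x <;> cases D (bxor x v) <;> cases D (bxor x t) <;> simp [signOf]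
  have h := gr20_sum_translate (S := P) (v := v) (fun x hx => hPV x hx v hv) (fun x => signOf (D x) * signOf (D (bxor x t)))
  rw [sum_congr rfl fun x _ => hflip x, sum_neg_distrib] at h
  linarith

/-! ### The character sums: `Ŝ² = 2048·S_R`, `S_R² = #R·S_R` -/

/-- **`Ŝ(y)² = 2048·S_R(y)`.**  See the module docstring. [this work] -/
theorem gr20_Shat_sq (D : (Fin (6 + 6) → Bool) → Bool) (hD : IsDegLeFun 2 D) (P V R : Finset (Fin (6 + 6) → Bool))
    (γ : Fin (6 + 6) → Bool) (t : ℝ) (hPmem : ∀ x, x ∈ P ↔ twist γ x = t) (hVmem : ∀ a, a ∈ V ↔ twist γ a = 1)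
    (x₀ : Fin (6 + 6) → Bool) (hx₀ : x₀ ∈ P) (hPV : ∀ x ∈ P, ∀ v ∈ V, bxor x v ∈ P) (hPcard : #P = 2048)
    (hR : R = V.filter fun a => ∀ v ∈ V, (D zeroVec ^^ D a ^^ D v ^^ D (bxor a v)) = false) (y : Fin (6 + 6) → Bool) :
    (∑ x ∈ P, signOf (D x) * twist x y) ^ 2 = 2048 * ∑ t ∈ R, signOf (D x₀) * signOf (D (bxor x₀ t)) * twist t y := by
  classical
  have hPimg : P = V.image (bxor x₀) := tw59_eq_image P V γ t hPmem hVmem x₀ hx₀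
  rw [sq, sum_mul_sum]
  -- inner sum over `P` re-indexed by `V`
  have hinner : ∀ x ∈ P, ∑ x' ∈ P, signOf (D x) * twist x y * (signOf (D x') * twist x' y) =
      ∑ t ∈ V, twist t y * (signOf (D x) * signOf (D (bxor x t))) := by
    intro x hx
    have hPx : P = V.image (bxor x) := tw59_eq_image P V γ t hPmem hVmem x hx
    rw [hPx, sum_image (fun a _ b _ h => by simpa using congrArg (bxor x) h)]
    refine sum_congr rfl fun t _ => ?_
    rw [twist_bxor_left]
    have h1 := twist_mul_self x y
    linear_combination (signOf (D x) * signOf (D (bxor x t)) * twist t y) * h1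
  rw [sum_congr rfl hinner, sum_comm]
  -- split `V` into `R` and the rest
  have hRsub : R ⊆ V := by rw [hR]; exact filter_subset _ _
  rw [← sum_filter_add_sum_filter_not V (fun t => t ∈ R)]
  have e1 : V.filter (fun t => t ∈ R) = R := by
    ext t; simp only [mem_filter]; exact ⟨fun h => h.2, fun h => ⟨hRsub h, h⟩⟩
  rw [e1]
  have hzero : ∑ t ∈ V.filter (fun t => t ∉ R), ∑ x ∈ P, twist t y * (signOf (D x) * signOf (D (bxor x t))) = 0 := by
    refine sum_eq_zero fun t ht => ?_
    obtain ⟨htV, htR⟩ := mem_filter.1 ht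
    have hex : ∃ v ∈ V, (D zeroVec ^^ D t ^^ D v ^^ D (bxor t v)) = true := by
      by_contra h
      push Not at h
      exact htR (by rw [hR]; exact mem_filter.2 ⟨htV, fun v hv => by simpa using h v hv⟩)
    obtain ⟨v, hv, htv⟩ := hex
    rw [← mul_sum, gr20_corr_zero D hD P V hPV t v hv htv, mul_zero]
  rw [hzero, add_zero, mul_sum]
  refine sum_congr rfl fun t ht => ?_
  have htR : ∀ v ∈ V, (D zeroVec ^^ D t ^^ D v ^^ D (bxor t v)) = false := by
    rw [hR] at ht; exact (mem_filter.1 ht).2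
  rw [sum_congr rfl fun x hx => by rw [gr20_corr_radical D hD V x₀ t htR x (hPimg ▸ hx)], sum_const, hPcard, nsmul_eq_mul]
  push_cast
  ring

/-- **`S_R(y)² = #R·S_R(y)`**: `η(t) = σ(x₀)σ(x₀⊕t)` is multiplicative on the group `R`. [this work] -/
theorem gr20_SR_sq (D : (Fin (6 + 6) → Bool) → Bool) (hD : IsDegLeFun 2 D) (V R : Finset (Fin (6 + 6) → Bool))
    (hVadd : ∀ x ∈ V, ∀ y ∈ V, bxor x y ∈ V) (x₀ : Fin (6 + 6) → Bool)
    (hR : R = V.filter fun a => ∀ v ∈ V, (D zeroVec ^^ D a ^^ D v ^^ D (bxor a v)) = false) (y : Fin (6 + 6) → Bool) :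
    (∑ t ∈ R, signOf (D x₀) * signOf (D (bxor x₀ t)) * twist t y) ^ 2 =
      #R * ∑ t ∈ R, signOf (D x₀) * signOf (D (bxor x₀ t)) * twist t y := by
  classical
  have hRmem : ∀ t, t ∈ R ↔ t ∈ V ∧ ∀ v ∈ V, (D zeroVec ^^ D t ^^ D v ^^ D (bxor t v)) = false := fun t => by
    rw [hR, mem_filter]
  have hRadd : ∀ t ∈ R, ∀ s ∈ R, bxor t s ∈ R := by
    intro t ht s hs
    rw [hRmem] at ht hs ⊢
    refine ⟨hVadd t ht.1 s hs.1, fun v hv => ?_⟩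
    rw [es_B_add_left D hD t s v, ht.2 v hv, hs.2 v hv]; rfl
  rw [sq, sum_mul_sum]
  have hinner : ∀ t ∈ R, ∑ s ∈ R, signOf (D x₀) * signOf (D (bxor x₀ t)) * twist t y *
      (signOf (D x₀) * signOf (D (bxor x₀ s)) * twist s y) = ∑ s ∈ R, signOf (D x₀) * signOf (D (bxor x₀ s)) * twist s y := by
    intro t ht
    have htR := ((hRmem t).1 ht).2
    -- re-index `s ↦ t ⊕ s`
    have hre := gr20_sum_translate (S := R) (v := t) (fun s hs => hRadd s hs t ht)
      (fun s => signOf (D x₀) * signOf (D (bxor x₀ t)) * twist t y * (signOf (D x₀) * signOf (D (bxor x₀ s)) * twist s y))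
    rw [← hre]
    refine sum_congr rfl fun s hs => ?_
    have hsV : s ∈ V := ((hRmem s).1 hs).1
    rw [twist_bxor_left, show bxor x₀ (bxor s t) = bxor (bxor x₀ t) s by rw [bxor_comm s t, iw_bxor_assoc],
      es_second_deriv D hD x₀ t s, htR s hsV]
    have h1 := twist_mul_self t y
    have hs1 : signOf (D x₀) * signOf (D x₀) = 1 := by cases D x₀ <;> simp [signOf]
    have key : signOf (D x₀ ^^ D (bxor x₀ t) ^^ D (bxor x₀ s) ^^ false) = signOf (D x₀) * signOf (D (bxor x₀ t)) * signOf (D (bxor x₀ s)) := by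
      cases D x₀ <;> cases D (bxor x₀ t) <;> cases D (bxor x₀ s) <;> simp [signOf]
    rw [key]
    have ht1 : signOf (D (bxor x₀ t)) * signOf (D (bxor x₀ t)) = 1 := by cases D (bxor x₀ t) <;> simp [signOf]
    linear_combination (signOf (D x₀) * signOf (D (bxor x₀ s)) * twist s y) * (signOf (D x₀) * signOf (D (bxor x₀ t)) * signOf (D (bxor x₀ t)) * signOf (D x₀) * h1 + signOf (D x₀) * signOf (D x₀) * ht1 + hs1)
  rw [sum_congr rfl hinner, sum_const, nsmul_eq_mul]

/-! ### Granularity -/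

/-- **Granularity of the hyperplane character sums.**  For quadratic `D` on 12 bits and a hyperplane `P = {(−1)^{γ·x} = t}` all of whose
parametrised 4-flat sums of `(−1)^D` (base point in `P`, directions in `γ^⊥`) are `≡ 0 (mod 8)`: every `Ŝ(y) = Σ_{x∈P} (−1)^{D(x)+x·y}` is
`0` or satisfies `|Ŝ(y)| ≥ 1024`.  See the module docstring. [this work] -/
theorem gr20_hyperplane_granular (D : (Fin (6 + 6) → Bool) → Bool) (hD : IsDegLeFun 2 D) (γ : Fin (6 + 6) → Bool) (hγ : γ ≠ zeroVec)
    (t : ℝ) (ht : t = 1 ∨ t = -1)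
    (H8 : ∀ x : Fin (6 + 6) → Bool, twist γ x = t → ∀ a b c d : Fin (6 + 6) → Bool, twist γ a = 1 → twist γ b = 1 → twist γ c = 1 →
      twist γ d = 1 → (8 : ℤ) ∣ ∑ ε : Fin 4 → Bool, sZ (D (fun j => x j ^^ decide (Odd #(univ.filter fun i =>
        ε i && (![a, b, c, d] : Fin 4 → Fin (6 + 6) → Bool) i j)))))
    (y : Fin (6 + 6) → Bool) :
    (∑ x ∈ univ.filter (fun x : Fin (6 + 6) → Bool => twist γ x = t), signOf (D x) * twist x y) = 0 ∨
      1024 ≤ |∑ x ∈ univ.filter (fun x : Fin (6 + 6) → Bool => twist γ x = t), signOf (D x) * twist x y| := by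
  classical
  set V := univ.filter (fun a : Fin (6 + 6) → Bool => twist γ a = 1) with hVdef
  set P := univ.filter (fun x : Fin (6 + 6) → Bool => twist γ x = t) with hPdef
  set R := V.filter (fun a => ∀ v ∈ V, (D zeroVec ^^ D a ^^ D v ^^ D (bxor a v)) = false) with hRdef
  have hVmem : ∀ a, a ∈ V ↔ twist γ a = 1 := fun a => by rw [hVdef, mem_filter]; simp
  have hPmem : ∀ x, x ∈ P ↔ twist γ x = t := fun x => by rw [hPdef, mem_filter]; simp
  have hVadd : ∀ x ∈ V, ∀ y ∈ V, bxor x y ∈ V := by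
    intro x hx y hy; rw [hVmem] at hx hy ⊢; rw [twist_bxor_right, hx, hy, mul_one]
  have hPV : ∀ x ∈ P, ∀ v ∈ V, bxor x v ∈ P := by
    intro x hx v hv; rw [hPmem] at hx ⊢; rw [hVmem] at hv; rw [twist_bxor_right, hx, hv, mul_one]
  have hPcard : #P = 2048 := tw59_card_half γ hγ t ht
  obtain ⟨x₀, hx₀⟩ : P.Nonempty := card_pos.1 (by rw [hPcard]; norm_num)
  have hRge : 512 ≤ #R := gr20_radical_ge D hD γ hγ t ht H8
  have h1 := gr20_Shat_sq D hD P V R γ t hPmem hVmem x₀ hx₀ hPV hPcard hRdef y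
  have h2 := gr20_SR_sq D hD V R hVadd x₀ hRdef y
  set S := ∑ x ∈ P, signOf (D x) * twist x y with hSdef
  set T := ∑ t ∈ R, signOf (D x₀) * signOf (D (bxor x₀ t)) * twist t y with hTdef
  have hT : T = 0 ∨ T = #R := by
    have : T * (T - #R) = 0 := by rw [mul_sub, ← sq, h2]; ring
    rcases mul_eq_zero.1 this with h | h
    · exact Or.inl h
    · exact Or.inr (by linarith)
  rcases hT with hT0 | hTR
  · left
    rw [hT0, mul_zero] at h1
    exact pow_eq_zero_iff two_ne_zero |>.1 h1
  · right
    have hRge' : (512 : ℝ) ≤ (#R : ℝ) := by exact_mod_cast hRge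
    have hsq : (1024 : ℝ) ^ 2 ≤ S ^ 2 := by rw [h1, hTR]; nlinarith
    by_contra hlt
    push Not at hlt
    nlinarith [sq_abs S, abs_nonneg S]

/-- **Granularity, `m`-form**: with `Ŝ = 64·m` (…TwelveQuadSpectrum's `qs_hyperplane_sum`), `m(y) = 0` or `|m(y)| ≥ 16`. [this work] -/
theorem gr20_hyperplane_granular_m (D : (Fin (6 + 6) → Bool) → Bool) (hD : IsDegLeFun 2 D) (γ : Fin (6 + 6) → Bool) (hγ : γ ≠ zeroVec)
    (t : ℝ) (ht : t = 1 ∨ t = -1)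
    (H8 : ∀ x : Fin (6 + 6) → Bool, twist γ x = t → ∀ a b c d : Fin (6 + 6) → Bool, twist γ a = 1 → twist γ b = 1 → twist γ c = 1 →
      twist γ d = 1 → (8 : ℤ) ∣ ∑ ε : Fin 4 → Bool, sZ (D (fun j => x j ^^ decide (Odd #(univ.filter fun i =>
        ε i && (![a, b, c, d] : Fin 4 → Fin (6 + 6) → Bool) i j)))))
    (m : (Fin (6 + 6) → Bool) → ℤ)
    (hm : ∀ y, ∑ x ∈ univ.filter (fun x : Fin (6 + 6) → Bool => twist γ x = t), (sZ (D x) : ℝ) * twist x y = 64 * (m y : ℝ))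
    (y : Fin (6 + 6) → Bool) : m y = 0 ∨ 16 ≤ |m y| := by
  have e : ∑ x ∈ univ.filter (fun x : Fin (6 + 6) → Bool => twist γ x = t), signOf (D x) * twist x y = 64 * (m y : ℝ) := by
    rw [← hm y]; exact sum_congr rfl fun x _ => by rw [tp_sZ_cast]
  rcases gr20_hyperplane_granular D hD γ hγ t ht H8 y with h | h <;> rw [e] at h
  · left; exact_mod_cast (mul_right_injective₀ (by norm_num : (64:ℝ) ≠ 0) (h.trans (mul_zero _).symm))
  · right
    rw [abs_mul, abs_of_nonneg (by norm_num : (0:ℝ) ≤ 64)] at h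
    have : (16 : ℝ) ≤ |(m y : ℝ)| := by linarith
    rw [← Int.cast_abs] at this
    exact_mod_cast this

end Summit.QuantumAdvantage.QuantumAdvantage.Theorems.CubicForrelation.NearExactIsExact

end
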